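import Literature.NumberTheory.DiophantineGeometry.StrongHall

/-!
# Crux `PolyHeightOfBoundedPrimes` (stmt-ABC-16006), line `Sketch` (idea `mordell-twist-cm-height`):
position of the core stub `stub_polyStrongHall` — two registered stubs, proved

The line (lead skeleton `Cruxes/PolyHeightOfBoundedPrimes/Lines/Sketch.lean`) transfers the crux
`B′ = A → H` to C⁺ = **polynomial strong Hall**: every primitive solution of `x³ − y² = z ≠ 0`
(Bombieri–Gubler 12.5.2, `IsPrimitiveHallSolution`) satisfies `max(|x|³, |z|) ≤ C · rad(z)^A` for
absolute `A, C`. This file proves two registered stubs about the position of C⁺: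

* `stub_polyStrongHall_of_strongHall` — the strong Hall conjecture of Bombieri–Gubler (Conj. 12.5.3,
  `ε`-form, `StrongHallConjecture`) implies C⁺ with `A = 9` (take `ε = 1`: `|x| ≤ C rad³`, `|y| ≤ C rad⁴`,
  `|z| ≤ |x|³ + |y|²`). With the tree theorem `strongHall_of_abcLe` (B–G Thm 12.5.12 (a) ⟹ (b)) this makes
  C⁺ a consequence of the `≤`-form of abc: the core stub is irrefutable short of `¬abc`.
* `stub_not_coprimeHallSzpiro` — the planner's alternative transfer hypothesis `CoprimeHallSzpiro`
  ("`x³ − y² = z ≠ 0` and no prime `p ≥ 5` divides both `x` and `y` ⟹ `max(|x|³, |z|) ≤ C rad(z)^A`") is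
  FALSE: `(x, y, z) = (3·4ᵏ, 5·8ᵏ, 2·64ᵏ)` has only the primes `2, 3` in `x`, `rad z = 2`, and
  `max(|x|³, |z|) ≥ 64ᵏ`. (The common factor `(2²ᵏ, 2³ᵏ)` is the non-primitivity that 12.5.2 removes;
  the corrected semistable shadow is C⁺ itself.) So the branch `crux_of_coprimeHallSzpiro` of the
  planner's sketch was vacuous and is dropped from the line.

Supports stmt-ABC-16006 (registered stubs, names and signatures verbatim).

References: E. Bombieri, W. Gubler, *Heights in Diophantine Geometry* (2006), 12.5.2–12.5.3 and
Thm 12.5.12 [BombieriGubler2006].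
-/

noncomputable section

-- single-conjunct summit ABC: the duplicate ABC.ABC is mandated (CONVENTIONS §2)
set_option linter.dupNamespace false

namespace Summit.ABC.ABC.Theorems.PolyHeightOfBoundedPrimes.MordellTwist

open UniqueFactorizationMonoid Literature.NumberTheory.DiophantineGeometry

/-- **Registered stub `stub_polyStrongHall_of_strongHall`.** The strong Hall conjecture (B–G Conj. 12.5.3,
`ε`-form) implies polynomial strong Hall with exponent `A = 9` and constant `2·max(C(1),1)³`: at
`ε = 1` one has `|x| ≤ C rad(z)³`, `|y| ≤ C rad(z)⁴`, hence `|x|³ ≤ C³ rad⁹`, `|y|² ≤ C² rad⁸ ≤ C³ rad⁹`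
and `|z| = |x³ − y²| ≤ 2 C³ rad⁹`. [cite: BombieriGubler2006, Conj. 12.5.3] -/
theorem stub_polyStrongHall_of_strongHall : StrongHallConjecture →
    ∃ A C : ℝ, ∀ x y z : ℤ, IsPrimitiveHallSolution x y z →
      ((max (|x| ^ 3) |z| : ℤ) : ℝ) ≤ C * ((radical z.natAbs : ℕ) : ℝ) ^ A := by
  intro hH
  obtain ⟨C₀, hC₀⟩ := hH 1 one_pos
  set C : ℝ := max C₀ 1 with hCdef
  have hC1 : 1 ≤ C := le_max_right _ _
  refine ⟨9, 2 * C ^ 3, fun x y z hsol ↦ ?_⟩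
  obtain ⟨hx, hy⟩ := hC₀ x y z hsol
  obtain ⟨hxyz, -, -⟩ := hsol
  set R : ℝ := ((radical z.natAbs : ℕ) : ℝ) with hRdef
  have hR1 : (1 : ℝ) ≤ R := by
    rw [hRdef]; exact_mod_cast Nat.radical_pos _
  have hR0 : (0 : ℝ) ≤ R := zero_le_one.trans hR1
  have hx' : |(x : ℝ)| ≤ C * R ^ (3 : ℝ) := by
    refine hx.trans ?_
    rw [show (2 : ℝ) + 1 = 3 by norm_num]
    exact mul_le_mul_of_nonneg_right (le_max_left _ _) (by positivity)
  have hy' : |(y : ℝ)| ≤ C * R ^ (4 : ℝ) := by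
    refine hy.trans ?_
    rw [show (3 : ℝ) + 1 = 4 by norm_num]
    exact mul_le_mul_of_nonneg_right (le_max_left _ _) (by positivity)
  have hx3 : |(x : ℝ)| ^ 3 ≤ C ^ 3 * R ^ (9 : ℝ) := by
    calc |(x : ℝ)| ^ 3 ≤ (C * R ^ (3 : ℝ)) ^ 3 := pow_le_pow_left₀ (abs_nonneg _) hx' 3
      _ = C ^ 3 * R ^ (9 : ℝ) := by
        rw [mul_pow, ← Real.rpow_natCast (R ^ (3 : ℝ)) 3, ← Real.rpow_mul hR0]; norm_num
  have hy2 : |(y : ℝ)| ^ 2 ≤ C ^ 3 * R ^ (9 : ℝ) := by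
    calc |(y : ℝ)| ^ 2 ≤ (C * R ^ (4 : ℝ)) ^ 2 := pow_le_pow_left₀ (abs_nonneg _) hy' 2
      _ = C ^ 2 * R ^ (8 : ℝ) := by
        rw [mul_pow, ← Real.rpow_natCast (R ^ (4 : ℝ)) 2, ← Real.rpow_mul hR0]; norm_num
      _ ≤ C ^ 3 * R ^ (9 : ℝ) :=
        mul_le_mul (pow_le_pow_right₀ hC1 (by norm_num))
          (Real.rpow_le_rpow_of_exponent_le hR1 (by norm_num)) (by positivity) (by positivity)
  have hz : |(z : ℝ)| ≤ 2 * C ^ 3 * R ^ (9 : ℝ) := by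
    have : (z : ℝ) = (x : ℝ) ^ 3 - (y : ℝ) ^ 2 := by exact_mod_cast hxyz.symm
    rw [this]
    calc |(x : ℝ) ^ 3 - (y : ℝ) ^ 2| ≤ |(x : ℝ) ^ 3| + |(y : ℝ) ^ 2| := abs_sub _ _
      _ = |(x : ℝ)| ^ 3 + |(y : ℝ)| ^ 2 := by rw [abs_pow, abs_pow]
      _ ≤ C ^ 3 * R ^ (9 : ℝ) + C ^ 3 * R ^ (9 : ℝ) := add_le_add hx3 hy2
      _ = 2 * C ^ 3 * R ^ (9 : ℝ) := by ring
  have hKR : 0 ≤ C ^ 3 * R ^ (9 : ℝ) := by positivity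
  rw [Int.cast_max, Int.cast_pow, Int.cast_abs, Int.cast_abs]
  exact max_le (hx3.trans (by linarith)) hz

/-- Curried form of `stub_polyStrongHall_of_strongHall`. [cite: BombieriGubler2006, Conj. 12.5.3] -/
theorem polyStrongHall_of_strongHall (hH : StrongHallConjecture) :
    ∃ A C : ℝ, ∀ x y z : ℤ, IsPrimitiveHallSolution x y z →
      ((max (|x| ^ 3) |z| : ℤ) : ℝ) ≤ C * ((radical z.natAbs : ℕ) : ℝ) ^ A :=
  stub_polyStrongHall_of_strongHall hH

/-- **Polynomial strong Hall follows from the `≤`-form of abc** (`strongHall_of_abcLe`, B–G Thm 12.5.12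
(a) ⟹ (b), then `stub_polyStrongHall_of_strongHall`): the core stub of the line is a consequence of abc.
[cite: BombieriGubler2006, Thm. 12.5.12 (a) ⟹ (b)] -/
theorem polyStrongHall_of_abcLe
    (habc : ∀ ε : ℝ, 0 < ε → ∃ C : ℝ, ∀ a b c : ℕ, IsABCTriple a b c →
      (c : ℝ) ≤ C * ((rad a b c : ℕ) : ℝ) ^ (1 + ε)) :
    ∃ A C : ℝ, ∀ x y z : ℤ, IsPrimitiveHallSolution x y z →
      ((max (|x| ^ 3) |z| : ℤ) : ℝ) ≤ C * ((radical z.natAbs : ℕ) : ℝ) ^ A :=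
  stub_polyStrongHall_of_strongHall (strongHall_of_abcLe habc)

/-- **Registered stub `stub_not_coprimeHallSzpiro`.** The "coprime-away-from-6" Hall–Szpiro statement is
false: witness family `(3·4ᵏ, 5·8ᵏ, 2·64ᵏ)` (`x³ − y² = z`, primes of `x` are `2, 3`, `rad z = 2`,
`max(|x|³,|z|) ≥ 64ᵏ > C·2^A` for large `k`). [folklore] -/
theorem stub_not_coprimeHallSzpiro :
    ¬ ∃ A C : ℝ, ∀ x y z : ℤ, x ^ 3 - y ^ 2 = z → z ≠ 0 →
      (∀ p : ℕ, p.Prime → (p : ℤ) ∣ x → (p : ℤ) ∣ y → p ≤ 3) →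
      ((max (|x| ^ 3) |z| : ℤ) : ℝ) ≤ C * ((radical z.natAbs : ℕ) : ℝ) ^ A := by
  rintro ⟨A, C, h⟩
  obtain ⟨k, hk⟩ := pow_unbounded_of_one_lt (C * 2 ^ A) (by norm_num : (1 : ℝ) < 64)
  have h4 : (4 : ℤ) ^ k = (2 ^ k) ^ 2 := by rw [← pow_mul, mul_comm, pow_mul]; norm_num
  have h8 : (8 : ℤ) ^ k = (2 ^ k) ^ 3 := by rw [← pow_mul, mul_comm, pow_mul]; norm_num
  have h64 : (64 : ℤ) ^ k = (2 ^ k) ^ 6 := by rw [← pow_mul, mul_comm, pow_mul]; norm_num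
  have hz : (3 * 4 ^ k : ℤ) ^ 3 - (5 * 8 ^ k) ^ 2 = 2 * 64 ^ k := by
    rw [h4, h8, h64]; ring
  have hz0 : (2 * 64 ^ k : ℤ) ≠ 0 := by positivity
  have hp : ∀ p : ℕ, p.Prime → (p : ℤ) ∣ 3 * 4 ^ k → (p : ℤ) ∣ 5 * 8 ^ k → p ≤ 3 := by
    intro p hp hx _
    have hx' : p ∣ 3 * 4 ^ k := by exact_mod_cast hx
    rcases (Nat.Prime.dvd_mul hp).mp hx' with h3 | h4'
    · exact Nat.le_of_dvd (by norm_num) h3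
    · have h2 : p ∣ 2 ^ 2 := by simpa using hp.dvd_of_dvd_pow h4'
      have := (Nat.prime_dvd_prime_iff_eq hp Nat.prime_two).mp (hp.dvd_of_dvd_pow h2)
      omega
  have key := h _ _ _ hz hz0 hp
  have hrad : radical (2 * 64 ^ k : ℤ).natAbs = 2 := by
    have h1 : (2 * 64 ^ k : ℤ).natAbs = 2 ^ (6 * k + 1) := by
      rw [Int.natAbs_mul, Int.natAbs_pow]
      norm_num
      rw [pow_succ, pow_mul]; norm_num; ring
    rw [h1, radical_pow_of_prime Nat.prime_two.prime (by omega), normalize_eq]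
  rw [hrad] at key
  have hmax : ((64 : ℝ) ^ k) ≤ ((max (|3 * 4 ^ k| ^ 3) |2 * 64 ^ k| : ℤ) : ℝ) := by
    have h1 : (64 ^ k : ℤ) ≤ max (|3 * 4 ^ k| ^ 3) |2 * 64 ^ k| := by
      refine le_trans ?_ (le_max_right _ _)
      rw [abs_of_pos (by positivity)]
      linarith [pow_pos (by norm_num : (0 : ℤ) < 64) k]
    exact_mod_cast h1
  push_cast at key hmax
  linarith

end Summit.ABC.ABC.Theorems.PolyHeightOfBoundedPrimes.MordellTwist

end
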